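import Summits.BirchSwinnertonDyer.Rank1Residual.ManinAdditive.UDCKummerLine
import Summits.BirchSwinnertonDyer.Rank1Residual.ManinAdditive.CuspidalKummerCubeLaws
import Literature.NumberTheory.EllipticCurves.ManinConstantGamma1Gamma0Comparison
import HarnessLib
import HarnessLib.Audit.Tags

/-!
# The `K`-rational Kummer/UDC line and the Shimura (`μ₃`) residual of RES₃♭ (cell bsd-f2-manin, -an g39, MEMO-an §82; nothing asserted)

bears_on stmt-BirchSwinnertonDyer-22968 (C3 `ManinPrimeToThreeAtNine`, skeleton `kato_shift_three` v25/v26, stub 7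
`stub_noRationalThreeTorsionCoprimeIsolatedResidual : NoRationalThreeTorsionCoprimeIsolatedResidual` = RES₃♭).  BSD is not proved by
this; C3 and Manin's conjecture are OPEN.  No `sorry`; `@[conjecture]` rows are candidates (nothing asserted); the three `theorem`s are
pure logic.

**Habitat of RES₃♭** (optimal `E₀`, `9 ∣ N`, `E₀[3]` reducible, NO rational point of order `3`, clauses 1–7): the unique Galois-stable
line of `E₀[3]` is `⟨T⟩` with `T = (X₀, Y₀)`, `X₀ ∈ ℚ` (root of `Ψ₃`), `Y₀ ∈ K = ℚ(√d) ∖ ℚ`; kernel character `ψ = χ_d`.  Data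
(Cremona galrep, D-an-18 habitat `9 ∣ N < 5·10⁵`, orbit-minimal): `χ₋₃`-only 1 743 classes ALL of type 3B.1.2 (`ψ = ω`, `μ₃ ⊂ E₀`);
isolated 659 = 415 of type 3B.1.2 + 244 generic 3B (`ψ ∉ {1, ω}`); isolated-CM 77; the ten residual classes `N ≤ 5000`
(270c1, 459c1, 594h1, 1485c1, 1566p1, 243a1, 486d1, 486e1, 1215d1, 2430m1) are ALL 3B.1.2.

**Dictionary** (an g39; `u` an analytic lift of `T`, `Λ_E = c·Λ₀(f)` optimal, `Λ₁(f) = periodLatticeGamma1 f`, tree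
`PMulLatticeLeGamma1OfTracelessPrime`: `3Λ₀(f) ⊆ Λ₁(f) ⊆ Λ₀(f)` at `9 ∣ N`):
`KummerShimura D u` (:= every `γ ∈ Γ₁(N)` has trivial Kummer period, `c{∞,γ∞}_f ∈ ℤ·3u + 3Λ_E`) ⟺ `Λ₁(f) = 3Λ₀(f) + ℤ(3u/c) ≠ Λ₀(f)`
⟺ `T = ±P` for the Shimura-kernel point `P = c·w/3` (LEAD p1 g14 `…ShimuraKernelRealStructure`) ⟺ `φ₀^*⟨T⟩ = E₀ ∩ Σ(N)` ⟺ the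
`X₁(N)`-optimal (Stevens) curve is `E₁ = E₀/⟨T⟩ ≠ E₀` [Vatsal 2005 Rem. 1.8 VERBATIM «E₁ is the quotient of E₀ by the subgroup V₀ = E₀ ∩ V,
for the Shimura subgroup V. Thus E₀ ≅ E₁ if and only if E₀ has trivial intersection with the Shimura subgroup. Since the Shimura subgroup
is of multiplicative type, we see that there is an isogeny E₁ → E₀ with kernel equal to a constant group scheme.»].  By [LO91] (Σ of
`μ`-type) `KummerShimura` forces `ψ = ω` (GENΣ below); for `ψ = ω` it is decided per class.

**Numerical census** (engine HOME/an/g39/kummerK-an-g39.py, exact `ℚ(√−3)`-arithmetic on the minimal model, `c = 1`; the normalised cube root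
`h` (`h³ = Θ_T`, `h(0) = −1`) of the `μ₃`-point Kummer series; `KummerShimura ⟹ h` is `𝔭`-adically bounded at `𝔭 ∣ 3` (the cover is then a
quotient of `X₁(N)`; (BI)/(AN) direction)): `h` UNBOUNDED (`v_𝔭(h_k) → −∞` linearly, `k ≤ 30`) for all ten residual classes and for 54b1, 171b1,
198b1 (so `φ₀^*μ₃ ⊄ Σ(N)`, `E₁ = E₀`); BOUNDED (`𝔭`-integral, `k ≤ 30`) for 27a1 and 54a1 (`φ₀^*μ₃ ⊂ Σ`, `E₁ = E₀/μ₃ = 27a3, 54a3`).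
Second invariant (HOME/an/g39/velu3-an-g39.py, Vélu + Cremona minimal models): the Lie exponent `n_φ` (`φ^*ω' = n_φ·ω`, Néron differentials
[Vatsal 2005 §1 p.4 VERBATIM «The isogeny φ is étale if and only if n_φ = ±1 … precisely one of φ and φ̂ is étale»]) of `φ : E₀ → E₀/μ₃` has
`v₃(n_φ) = 1` exactly for 27a1, 54a1 and `v₃(n_φ) = 0` for the other thirteen: on these fifteen classes `φ₀^*μ₃ ⊂ Σ(N) ⟺ 3 ∣ n_φ`.

**Structure (on paper).**  (i) UNCONDITIONAL IDENTITY: if `Λ₁(f) ≠ Λ₀(f)` at `9 ∣ N` then the Shimura cover `u : E₁ → E₀` is `w ↦ (c₀/c₁)w`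
in Néron coordinates, so `n_u = ±c₀/c₁` and `n_φ·n_u = 3`: `ord₃(c₀) − ord₃(c₁) = 1 − v₃(n_φ)` — the LOCAL INVARIANT AT 3 controlling
`ord₃(c_E)` on the Shimura stratum is the Lie exponent of the `μ₃`-isogeny (tree: `cesnaviciusNeururerSaha_lemma_6_5_dvd_holds` `c₁ ∣ c₀` and
the traceless-prime converse `c₀ ∣ 3c₁`).  (ii) Hence Manin on that stratum ⟺ (`n_u = ±1`, i.e. the Shimura cover is ÉTALE = the
`(E₀,E₁)`-fragment of STEVENS' conjecture at `ℓ = 3` [Vatsal 2005 Conj. 1.9; Thm 1.10 (semistable, `ℓ` odd) and Thm 1.11 (`ℓ ≥ 7` ordinary)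
do NOT cover additive `3`]) ∧ (`3 ∤ c₁`).  (iii) Off the stratum (`E₁ = E₀`, all generic classes and 13/15 of the `μ₃` sample) the
`K`-rational UDC line applies: (NC-a) `KummerCoverSubgroup` is ALREADY stated for an arbitrary lift `u` (PROVED p725557), (HOLB)/(INVB)/(INV)
are `u`-only (PROVED p731758/p731884/p731378); new `K`-pieces = (BI)_K, (DICT/INT/QEXN)_K with algebraic-integer coefficients, and UDC with
ALGEBRAIC-INTEGER coefficients (tree fact `Literature.NumberTheory.Automorphic.CalegariDimitrovTang2025_unboundedDenominators_algInt`,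
CDT Remarks 58–59).  THE SPLIT (PROVED below, pure logic): RES₃♭ ⟸ EXISTC ∧ GENΣ ∧ KLINE ∧ RESΣ.
PARTITION 0 new data jobs (local exact scripts only) · beyond-print theorem: no · BSD is not proved by this.
[cite: Vatsal2005, §1 Rem. 1.8, Conj. 1.9, Thm. 1.10, Thm. 1.11, p.4 (n_φ) (VERBATIM quotes above; held paper:doi-10-1017-s147474800500006x)]
[cite: LingOesterle1991, Thm. 1 (the Shimura subgroup is of multiplicative type; engine of GENΣ)]
[cite: CalegariDimitrovTang2025, Thm. 1.0.1 and Remarks 58–59 (algebraic-integer coefficients)]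
[cite: KurthLong2008, Prop. 18] [cite: Stevens1989, §2, Thm. 2.3]

TYPER NOTE (typer g21, T-an-47).  SOURCE = HOME/an/g39/UDCKummerLineK-an-g39.lean (file A) sha16 a0b393669aa643d2 (338 l.; = the sha in
HOME/an/g39/SHA16-g39.txt and HANDOFF «an gen 39»; MEMO-an §82.4 still prints the pre-final sha 17426dde19a00790; an: farm rc 0 · 0 warn ·
0 s∗rries; BC7 9/9 CLEAN: g39-bc7-a.out 707c4193f3308af9, -b ab4772d7385855f5, -c 1f396a5b3cf5e8a4) VERBATIM except this note (an's own
`@[conjecture]` tags; bodies, docstrings, names, namespace `…ManinAdditive.UDCKummerLineK`, imports untouched).  ROUTE-INDEPENDENT: imports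
`…ManinAdditive.UDCKummerLine` (p725103), `…ManinAdditive.CuspidalKummerCubeLaws` (home of RES₃♭
`CuspidalKummerThree.NoRationalThreeTorsionCoprimeIsolatedResidual`), `Literature…ManinConstantGamma1Gamma0Comparison` — no `Theses` module in the
transitive import cone (typer script: 107 Summits modules walked, 0 Theses edges).  HONEST FRAMING (typer summary; details = an's text below and
MEMO-an §82, HOME/an/MEMO-an-82.md 7dbc46098fdb52fd): LENS an (period lattices Λ₀(f)/Λ₁(f), σ-function Kummer theory over `K = ℚ(√−3)`, Lie
exponents).  WHAT THIS FILE IS: the split of C3's last non-print stub RES₃♭ (skeleton kato_shift_three v27/v28 `stub_noRationalThreeTorsionCoprime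
IsolatedResidual`) along the Shimura subgroup: real defs `IsShortThreeTorsionC` / `tangentSlopeC` / `kummerCubeSeriesC` / `IsThreeAdicallyBoundedAlg`
/ `IsMuThreeType` / `KummerShimura` / `UnboundedDenominatorsWeightAlgInt` (statement shape of CDT with algebraic-integer coefficients; the tree's
named fact is `Literature.NumberTheory.Automorphic.CalegariDimitrovTang2025_unboundedDenominators_algInt`, NOT re-declared here); `@[conjecture]`
nodes (BI)_K `KummerCubeRootThreeBoundedK`, (AN)_K `KummerCubeRootCongruenceOfBoundedK`, (AN♮)_K `KummerCubeRootCongruenceOfBoundedKOfUDC`, (NCΣ)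
`KummerCoverNoncongruenceOfNotShimura` (an: PROVED Theorems-side in file B `kummerCoverNoncongruenceOfNotShimura_holds` — prover target, not landed
here), KLINE `NonShimuraThreeTorsionCaseAtNine` (+ KLINE♮ `…GermFree`), GENΣ `KummerNotShimuraOfGeneric`, **E-an-201 `ShimuraKernelMuTypeAtNine`**,
DICTΣ `KummerShimuraLattice`, EXISTC `ReducibleShortThreeTorsionLiftC`, RESΣ `ShimuraMuThreeCaseAtNine` (the honest residual = Manin on the Shimura
stratum), **E-an-200 `ShimuraCoverEtaleAtNine`** (the Stevens fragment at additive 3); PROVED (an, pure logic, kernel-checked here):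
`nonShimuraThreeTorsionCaseAtNine_of_pieces : NCΣ → (BI)_K → (AN)_K → KLINE` and `noRationalThreeTorsionCoprimeIsolatedResidual_of_kLine :
EXISTC → GENΣ → KLINE♮ → RESΣ → RES₃♭` (H21 audit: proof-of-item closed=true modulo the conjecture nodes).  NOT IN PRINT: E-an-200 is the
`(E₀,E₁)`-fragment of Stevens' conjecture at `ℓ = 3` ADDITIVE — [Vatsal2005] Thm 1.10 (semistable, odd ℓ) / Thm 1.11 (ℓ ≥ 7) do not cover it
([corpus:paper:doi-10-1017-s147474800500006x p.4, 6–7, 41], an's reading); E-an-201's engine [LingOesterle1991, Thm 1] («Σ(N) is of μ-type») is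
printed but NOT a tree fact (acq-13296/13376 open); RESΣ/KLINE are Manin-type laws, unproved.  BC5 WITNESS: (an, exact local engines
kummerK-an-g39.py 67cdcacaad9e1b36 / velu3-an-g39.py 0c44db145ba62f5e; outs 08f5a61869cc615f / a5d385fb80535478 / e938d768b78cc6bc) 15 classes with
`9 ∣ N`: μ₃-Kummer cube root UNBOUNDED for the 10 RES₃♭ classes `N ≤ 5000` + 54b1/171b1/198b1 (not Shimura, `v₃(n_φ) = 0`), BOUNDED for 27a1/54a1
(Shimura, `v₃(n_φ) = 1`, `c₀ = c₁ = 1`) — 15/15 «φ₀^*μ₃ ⊂ Σ ⟺ 3 ∣ n_φ», 0 violations of E-an-200/RESΣ/KLINE; (typer, HOME/MANIN-ADDITIVE-CREMONA-TIER-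
v1.tsv.gz 9e900c04e95a8bd4) 374 108 Cremona-certified optimal classes with `9 ∣ N`, `N < 5·10⁵`, all `c₀ = 1` (30 976 of them with a rational
3-isogeny = the reducible habitat's superset) ⇒ a violation of E-an-200 (`|c₀| = 3|c₁|`) is excluded throughout that range.  CHEAPEST FALSIFIER
(an): an optimal `E₀`, `9 ∣ N`, with bounded μ₃-Kummer cube root and `v₃(n_φ) = 0` (D-an-23 runs it on all μ₃-type optimal `E₀ < 5·10⁵`).
REFUTER VERDICTS: ref1 R-an-75 PENDING at landing; ref2 PENDING.  Typer checks: all 21 decl names fresh tree-wide (one rg pass over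
Summits/BirchSwinnertonDyer + Literature/NumberTheory); all 7 cite keys in references.bib; no instances, no notation; 338 + note < 400 lines;
own farm check recorded on HOME/STATUS.  FILE B (`Theorems/ManinLocalTwoThreeUDCLineKAtNine.lean`, 38e9d5c3a900670d) is a PROVER-ONLY target
(perm.theorems-prover-only for -ty) — L-an-g39-1 / p-seats.  PARTITION 0 · beyond-print theorem: NO · bears_on: stmt-BirchSwinnertonDyer-22968
(C3 `ManinPrimeToThreeAtNine`).  BSD is not proved by this; Manin `c = 1` is not proved by this; C3 OPEN.
-/

set_option autoImplicit false

noncomputable section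

open scoped Classical MatrixGroups ModularForm PeriodPair UpperHalfPlane Manifold
open PowerSeries CongruenceSubgroup Complex
open WeierstrassCurve Literature.NumberTheory.EllipticCurves Literature.NumberTheory.EllipticCurves.ModularForms
open Summit.BirchSwinnertonDyer.Rank1Residual.ManinAdditive.CuspidalKummer
open Summit.BirchSwinnertonDyer.Rank1Residual.ManinAdditive.CuspidalKummerThree
open Summit.BirchSwinnertonDyer.Rank1Residual.ManinAdditive.UDCKummerLine

namespace Summit.BirchSwinnertonDyer.Rank1Residual.ManinAdditive.UDCKummerLineK

/-! ## §0 Definitions (the `K`-rational dictionary) -/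

section Defs

variable {W : WeierstrassCurve ℚ} [W.IsElliptic] {N : ℕ} [NeZero N]

/-- `(X₀, Y₀)`, `X₀ ∈ ℚ`, `Y₀ ∈ ℂ`, is a point of exact order `3` of the short model `E_{W,c}` base-changed to `ℂ`: a nonsingular
affine point whose (rational) abscissa is a root of `Ψ₃`.  Every Galois-stable line `⟨T⟩ ⊂ E[3]` has such a generator
(`x(−T) = x(T)`), `Y₀² ∈ ℚ`. [folklore] -/
def IsShortThreeTorsionC (W : WeierstrassCurve ℚ) (c : ℤ) (X₀ : ℚ) (Y₀ : ℂ) : Prop :=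
  ((shortModel W c).map (algebraMap ℚ ℂ)).toAffine.Nonsingular (X₀ : ℂ) Y₀ ∧ (shortModel W c).Ψ₃.IsRoot X₀

/-- Tangent slope at the `K`-point `(X₀, Y₀)` of the short model: `α = (3X₀² + a₄)/(2Y₀) ∈ K`. [folklore] -/
def tangentSlopeC (W : WeierstrassCurve ℚ) (c : ℤ) (X₀ : ℚ) (Y₀ : ℂ) : ℂ :=
  (3 * (X₀ : ℂ) ^ 2 + ((shortModel W c).a₄ : ℂ)) / (2 * Y₀)

/-- The pole-cleared tangent-line Kummer series of the `K`-point `T = (X₀, Y₀)` along the (rational) germ `z`: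
`Θ_T = (z³y)(z) − Y₀z³ − α·((z²x)(z)·z − X₀z³) ∈ −1 + zK⟦z⟧` (the tree's `kummerCubeSeries` with `Y₀, α ∈ K`). [folklore] -/
def kummerCubeSeriesC (W : WeierstrassCurve ℚ) (c : ℤ) (X₀ : ℚ) (Y₀ : ℂ) (z : ℚ⟦X⟧) : ℂ⟦X⟧ :=
  PowerSeries.map (algebraMap ℚ ℂ) ((shortModel W c).formalYMulCube.subst z) - Y₀ • PowerSeries.map (algebraMap ℚ ℂ) (z ^ 3)
    - tangentSlopeC W c X₀ Y₀ •
      PowerSeries.map (algebraMap ℚ ℂ) ((shortModel W c).formalXMulSq.subst z * z - X₀ • z ^ 3)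

/-- A series with algebraic coefficients is `3`-ADICALLY BOUNDED AT EVERY PRIME OVER `3`: for some `K` and every `n` there is an
integer `M` prime to `3` with `M·3^K·hₙ` an algebraic integer (for `h ∈ ℚ⟦q⟧` this is the tree's `IsThreeAdicallyBounded`). [folklore] -/
def IsThreeAdicallyBoundedAlg (h : ℂ⟦X⟧) : Prop :=
  ∃ K : ℕ, ∀ n : ℕ, ∃ M : ℕ, ¬ 3 ∣ M ∧ _root_.IsIntegral ℤ ((M : ℂ) * 3 ^ K * coeff n h)

/-- The `K`-point `(X₀, Y₀)` is of `μ₃`-TYPE: `Y₀² ∈ −3·ℚ²`, i.e. `Y₀ ∈ √−3·ℚ` — Galois acts on `±T` through `ω = χ₋₃`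
(Cremona/Sutherland label 3B.1.2 when there is no rational point of order 3). [folklore] -/
def IsMuThreeType (Y₀ : ℂ) : Prop := ∃ r : ℚ, Y₀ ^ 2 = -3 * (r : ℂ) ^ 2

/-- `φ^*T ∈ Σ(N)` in the tree's `J₀(N)`-free currency: EVERY `γ ∈ Γ₁(N)` has trivial Kummer period along the lift `u` of `T`
(`c{∞,γ∞}_f ∈ ℤ·3u + 3Λ_E`), i.e. the Kummer group `Γ_T` contains `Γ₁(N)` (the triple cover `Y_T → X₀(N)` is a quotient of
`X₁(N)`).  Equivalent (for optimal `D`, `9 ∣ N`) to `Λ₁(f) = 3Λ₀(f) + ℤ·(3u/c) ≠ Λ₀(f)`. [cite: Vatsal2005, §1 Rem. 1.8 (E₁ = E₀/(E₀ ∩ V))] -/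
def KummerShimura (D : ModularParametrizationData W N) (u : ℂ) : Prop :=
  ∀ γ : Gamma0 N, (γ : SL(2, ℤ)) ∈ Gamma1 N → KummerPeriodTrivial D u γ

end Defs

/-! ## §1 The `K`-rational UDC line (off the Shimura stratum) -/

/-- **(BI)_K `KummerCubeRootThreeBoundedK` (support-sized; E-an-55's cube mechanism over `K`).**  If `3 ∣ c` and `9 ∣ N` the Kummer
series of a `K`-point of order `3` with rational abscissa has a normalised formal cube root `h ∈ K⟦q⟧` (`h³ = Θ_T`, `h(0) = −1`) that is
`3`-adically bounded at every `𝔭 ∣ 3`.  On paper: `a_{3m} = 0`, Honda ⟹ `z_W ∈ qℤ₍₃₎⟦q⟧`, `z_W = [3]([c/3]·)`; `f_T∘[3] = κ·g_T³` in `K(E)`;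
`O_{K,𝔭}⟦q⟧` is factorial hence integrally closed (the three cube roots differ by `μ₃ ⊂ O_K` when `K = ℚ(√−3)`).  27a1 control: with the
artificial value `c := 3` both the rational and the `μ₃`-point cube roots come out `3`-integral (engine kummerK-an-g39.py).  Why it might fail:
not on paper; Lean cost = Weierstrass preparation over `O_{K,𝔭}`. [cite: Washington1997, Thm. 7.3 and §7.1 (shape: `ℤ_p⟦T⟧` is a UFD)] -/
@[conjecture]
def KummerCubeRootThreeBoundedK : Prop :=
  ∀ (W : WeierstrassCurve ℚ) [W.IsElliptic] [W.IsGloballyMinimal] {N : ℕ} [NeZero N]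
    (D : ModularParametrizationData W N) (a : ℕ → ℤ), (∀ n, (a n : ℂ) = cuspCoeff D.f n) →
    9 ∣ N → ∀ (X₀ : ℚ) (Y₀ : ℂ), IsShortThreeTorsionC W D.c X₀ Y₀ →
    ∀ z : ℚ⟦X⟧, IsParamGerm W D.c a z → (3 : ℤ) ∣ D.c →
    ∃ h : ℂ⟦X⟧, h ^ 3 = kummerCubeSeriesC W D.c X₀ Y₀ z ∧ constantCoeff h = -1 ∧ IsThreeAdicallyBoundedAlg h

/-- **Printed input, algebraic-integer version (statement shape; used INSIDE (AN♮)_K): the Unbounded Denominators theorem for a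
width-one `q`-expansion with ALGEBRAIC-INTEGER coefficients**, unbundled meromorphic-at-the-cusps rendering (exponential growth of every
slash) as in the tree's `UnboundedDenominatorsWeight`.  [cite: CalegariDimitrovTang2025, Thm. 1.0.1 and Remarks 58–59 (arXiv:2109.09040
numbering; the tree's named fact `Literature.NumberTheory.Automorphic.CalegariDimitrovTang2025_unboundedDenominators_algInt` is the
HOLOMORPHIC-at-the-cusps bundled rendering; the passage to this unbundled form is p2's `UDWOfCDT` argument, p726609, re-run with `IsIntegral ℤ`)] -/
def UnboundedDenominatorsWeightAlgInt (k : ℤ) : Prop :=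
  ∀ (Γ : Subgroup SL(2, ℤ)), Γ.FiniteIndex → ∀ F : ℍ → ℂ, MDifferentiable 𝓘(ℂ) 𝓘(ℂ) F →
    (∀ γ ∈ Γ, F ∣[k] γ = F) →
    (∀ g : SL(2, ℤ), ∃ C A m : ℝ, ∀ τ : ℍ, A ≤ τ.im → ‖(F ∣[k] g) τ‖ ≤ C * Real.exp (m * τ.im)) →
    (∃ b : ℕ → ℂ, (∀ n, _root_.IsIntegral ℤ (b n)) ∧ ∀ τ : ℍ,
      HasSum (fun n : ℕ => b n * Complex.exp (2 * Real.pi * Complex.I * (τ : ℂ) * n)) (F τ)) →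
    ∃ M : ℕ, 0 < M ∧ ∀ γ ∈ CongruenceSubgroup.Gamma M, F ∣[k] γ = F

/-- **(AN)_K `KummerCubeRootCongruenceOfBoundedK` (crux-sized; engine = UDC with algebraic-integer coefficients).**  For an optimal datum,
a `K`-point `(X₀, Y₀)` of order `3` with rational abscissa and analytic lift `u`, the germ `z` and a normalised cube root `h` of `Θ_T`:
if `h` is `3`-adically bounded at the primes over `3` then the Kummer character vanishes on `Γ₀(N) ∩ Γ(M)` for some `M ≥ 1`.  On paper as (AN):
the witness `F = C₀·B_d·kummerMinBlock` of the B-line ((HOLB) `KummerMinimalWitnessExtensionB`, (INVB) `KummerMinimalWitnessInvarianceB` —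
both stated for an arbitrary lift `u`, PROVED p731758/p731884) has `q`-coefficients in `O_K[1/M′]` with bounded denominators ((DICT)/(INT)/(QEXNB)
re-run over `K`), and `UnboundedDenominatorsWeightAlgInt` applies.  Why it might fail: not on paper given CDT Rem. 58–59; Lean cost = the
`K`-coefficient bookkeeping of (DICT)_K/(INT)_K (torsion points of order `3` on the minimal model are `𝔭`-integral away from `3`, Cassels).
[cite: CalegariDimitrovTang2025, Remarks 58–59 (engine)] -/
@[conjecture]
def KummerCubeRootCongruenceOfBoundedK : Prop :=
  ∀ (W : WeierstrassCurve ℚ) [W.IsElliptic] [W.IsGloballyMinimal] {N : ℕ} [NeZero N]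
    (D : ModularParametrizationData W N) (a : ℕ → ℤ), (∀ n, (a n : ℂ) = cuspCoeff D.f n) →
    (∀ z ∈ D.L.lattice, ∃ w ∈ periodLattice D.f, z = D.c * w) →
    ∀ (X₀ : ℚ) (Y₀ : ℂ), IsShortThreeTorsionC W D.c X₀ Y₀ →
    ∀ u : ℂ, u ∉ D.L.lattice → 3 * u ∈ D.L.lattice →
    (D.c : ℂ) ^ 2 * D.L.weierstrassP u = (X₀ : ℂ) → (D.c : ℂ) ^ 3 * D.L.derivWeierstrassP u / 2 = Y₀ →
    ∀ z : ℚ⟦X⟧, IsParamGerm W D.c a z →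
    ∀ h : ℂ⟦X⟧, h ^ 3 = kummerCubeSeriesC W D.c X₀ Y₀ z → constantCoeff h = -1 → IsThreeAdicallyBoundedAlg h →
    ∃ M : ℕ, 0 < M ∧ ∀ γ : Gamma0 N, (γ : SL(2, ℤ)) ∈ CongruenceSubgroup.Gamma M → KummerPeriodTrivial D u γ

/-- **(AN♮)_K content half: UDC with algebraic-integer coefficients (all weights) implies (AN)_K.** [folklore] -/
@[conjecture]
def KummerCubeRootCongruenceOfBoundedKOfUDC : Prop :=
  (∀ k : ℤ, UnboundedDenominatorsWeightAlgInt k) → KummerCubeRootCongruenceOfBoundedK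

/-- **(NCΣ) `KummerCoverNoncongruenceOfNotShimura` (M-sized, KERNEL-PROVABLE from the tree: NC-a `KummerCoverSubgroup` (PROVED
`kummerCoverSubgroup_holds`, stated for an arbitrary lift `u`) + `TypeIINoncongruence` (PROVED `typeIINoncongruence_holds`) + the glue
`Γ(MN) ≤ Γ₀(N) ∩ Γ(M)` of `kummerCoverNoncongruence_nine_of_pieces`, with NC-b's conclusion replaced by the HYPOTHESIS `¬KummerShimura`).**
If some `γ ∈ Γ₁(N)` has a nontrivial Kummer period along `u`, then so does some element of `Γ₀(N) ∩ Γ(M)` for every `M ≥ 1`.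
Why it might fail: it cannot (Kurth–Long type II + Wohlfahrt). [cite: KurthLong2008, Prop. 18] -/
@[conjecture]
def KummerCoverNoncongruenceOfNotShimura : Prop :=
  ∀ (W : WeierstrassCurve ℚ) [W.IsElliptic] [W.IsGloballyMinimal] {N : ℕ} [NeZero N]
    (D : ModularParametrizationData W N),
    (∀ z ∈ D.L.lattice, ∃ w ∈ periodLattice D.f, z = D.c * w) →
    ∀ u : ℂ, u ∉ D.L.lattice → 3 * u ∈ D.L.lattice → ¬ KummerShimura D u →
    ∀ M : ℕ, 0 < M → ∃ γ : Gamma0 N, (γ : SL(2, ℤ)) ∈ CongruenceSubgroup.Gamma M ∧ ¬ KummerPeriodTrivial D u γ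

/-- **KLINE `NonShimuraThreeTorsionCaseAtNine` (the `K`-rational UDC target; E-an-55's binders with `Y₀ ∈ ℂ`).**  An optimal curve with
`9 ∣ N` carrying a `K`-point `T = (X₀, Y₀)` of order `3` with rational abscissa whose pull-back is NOT in the Shimura subgroup (some
`γ ∈ Γ₁(N)` has a nontrivial Kummer period along a lift `u` of `T`) has `3 ∤ c`.  Habitat: every RES₃♭ class with `E₁ = E₀` — all 244 generic
orbit-minimal classes (by GENΣ) and, numerically, 13 of the 15 `μ₃`-type classes tested incl. all ten residual classes `N ≤ 5000`.  Census:
`c₀ = 1` throughout (Cremona).  Why it might fail: as Manin's conjecture on this locus; mechanism = (NCΣ) ∧ (BI)_K ∧ (AN)_K (PROVED edge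
`nonShimuraThreeTorsionCaseAtNine_of_pieces`). [cite: CalegariDimitrovTang2025, Thm. 1.0.1 and Remarks 58–59 (engine)] -/
@[conjecture]
def NonShimuraThreeTorsionCaseAtNine : Prop :=
  ∀ (W : WeierstrassCurve ℚ) [W.IsElliptic] [W.IsGloballyMinimal] {N : ℕ} [NeZero N]
    (D : ModularParametrizationData W N) (a : ℕ → ℤ), (∀ n, (a n : ℂ) = cuspCoeff D.f n) → 9 ∣ N →
    (∀ z ∈ D.L.lattice, ∃ w ∈ periodLattice D.f, z = D.c * w) →
    ∀ (X₀ : ℚ) (Y₀ : ℂ), IsShortThreeTorsionC W D.c X₀ Y₀ →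
    ∀ u : ℂ, u ∉ D.L.lattice → 3 * u ∈ D.L.lattice →
    (D.c : ℂ) ^ 2 * D.L.weierstrassP u = (X₀ : ℂ) → (D.c : ℂ) ^ 3 * D.L.derivWeierstrassP u / 2 = Y₀ →
    ¬ KummerShimura D u → ∀ z : ℚ⟦X⟧, IsParamGerm W D.c a z → ¬ (3 : ℤ) ∣ D.c

/-- **KLINE ⟸ (NCΣ) ∧ (BI)_K ∧ (AN)_K (PROVED; pure logic, the analytic lift is a binder).** [folklore] -/
theorem nonShimuraThreeTorsionCaseAtNine_of_pieces (hNC : KummerCoverNoncongruenceOfNotShimura)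
    (hBI : KummerCubeRootThreeBoundedK) (hAN : KummerCubeRootCongruenceOfBoundedK) : NonShimuraThreeTorsionCaseAtNine := by
  intro W _ _ N _ D a ha h9 hopt X₀ Y₀ hT u hu₁ hu₂ hX hY hS z hz h3
  obtain ⟨h, hh3, hh0, hK⟩ := hBI W D a ha h9 X₀ Y₀ hT z hz h3
  obtain ⟨M, hM, hcong⟩ := hAN W D a ha hopt X₀ Y₀ hT u hu₁ hu₂ hX hY z hz h hh3 hh0 hK
  obtain ⟨γ, hγ, hne⟩ := hNC W D hopt u hu₁ hu₂ hS M hM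
  exact hne (hcong γ hγ)

/-! ## §2 The Shimura side: GENΣ, EXISTC, RESΣ and the Stevens fragment -/

/-- **GENΣ `KummerNotShimuraOfGeneric` (theorem on paper; engine [LO91, Thm 1]: the Shimura subgroup is of `μ`-type).**  For an optimal
datum with `9 ∣ N` and a `K`-point `T = (X₀, Y₀)` of order `3` with rational abscissa that is neither rational (`Y₀ ∉ ℚ`) nor of `μ₃`-type
(`Y₀ ∉ √−3·ℚ`), some `γ ∈ Γ₁(N)` has a nontrivial Kummer period: `φ^*T ∉ Σ(N)` because Galois acts on `±φ^*T` through `χ_d ≠ ω`.  The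
REAL case (`d > 0`) is kernel-provable from LEAD p1 g14 `conj_derivWeierstrassP_kernel` (`℘'` of the kernel generator is purely imaginary,
while `Y₀ ∈ ℝ ∖ {0}`); the imaginary generic case needs the printed `μ`-type statement.  Habitat: the 244 generic orbit-minimal isolated
classes of D-an-18 (first 4725b1, 13230bk1).  Why it might fail: only through the `J₀(N)`-free typing (the dictionary `KummerShimura ⟺
φ^*T ∈ Σ` uses optimality and `3Λ₀ ⊆ Λ₁`). [cite: LingOesterle1991, Thm. 1 (engine)] [cite: Vatsal2005, §1 p.1 («V is of multiplicative type»)] -/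
@[conjecture]
def KummerNotShimuraOfGeneric : Prop :=
  ∀ (W : WeierstrassCurve ℚ) [W.IsElliptic] [W.IsGloballyMinimal] {N : ℕ} [NeZero N]
    (D : ModularParametrizationData W N),
    (∀ z ∈ D.L.lattice, ∃ w ∈ periodLattice D.f, z = D.c * w) → 3 ^ 2 ∣ N →
    ∀ (X₀ : ℚ) (Y₀ : ℂ), IsShortThreeTorsionC W D.c X₀ Y₀ → (∀ y : ℚ, Y₀ ≠ (y : ℂ)) → ¬ IsMuThreeType Y₀ →
    ∀ u : ℂ, u ∉ D.L.lattice → 3 * u ∈ D.L.lattice →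
    (D.c : ℂ) ^ 2 * D.L.weierstrassP u = (X₀ : ℂ) → (D.c : ℂ) ^ 3 * D.L.derivWeierstrassP u / 2 = Y₀ →
    ¬ KummerShimura D u

/-- **E-an-201 `ShimuraKernelMuTypeAtNine` (the PRINTED ENGINE of GENΣ in lattice currency; candidate, nothing asserted): the Shimura
kernel `E₀ ∩ Σ(N)` is `μ₃` as a Galois module.**  For a lattice-optimal datum at `9 ∣ N` with `Λ₁(f) ≠ Λ₀(f)`: `Λ₁(f) ⊄ 3Λ₀(f)` (the kernel
has order `3`, not `9` — Weil pairing) and for every `w ∈ Λ₁(f) ∖ 3Λ₀(f)` the kernel generator `P = c·w/3` has RATIONAL abscissa and ordinate in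
`√−3·ℚ` on the short model `E_{W,c}` (i.e. `σP = ω(σ)P`).  The complex-conjugation shadow (`℘(P) ∈ ℝ`, `℘'(P) ∈ iℝ`, `P̄ = −P`) is the tree
theorem `…ShimuraKernelRealStructure.conj_weierstrassP_kernel` / `conj_derivWeierstrassP_kernel` / `no_rational_kernel_generator` (C3 LEAD p1
g14, unconditional).  BC5: 27a1 (`P = (0, Y)`, `Y² ∈ −3ℚ²`) and 54a1 (`X = −9/4`) — the two `Λ₁ ≠ Λ₀` classes with `9 ∣ N ≤ 5000`, where the
bounded `μ₃`-Kummer cube root identifies `T = ±P` (kummerK-an-g39.py).  Why it might fail: not on paper ([LO91, Thm 1] `Σ(N)` is of `μ`-type for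
every `N`; «Σ of μ-type» is NOT yet a tree fact — cf. `PlusIndexLaws`, `ShimuraCuspLifting` docstrings); Lean cost = Galois action on
`E(ℚ̄)` vs the analytic uniformisation.  Cheapest falsifier: a `Λ₁ ≠ Λ₀` class whose kernel abscissa is irrational (none).
[cite: LingOesterle1991, Thm. 1] [cite: Vatsal2005, §1 Rem. 1.8] -/
@[conjecture]
def ShimuraKernelMuTypeAtNine : Prop :=
  ∀ (W : WeierstrassCurve ℚ) [W.IsElliptic] [W.IsGloballyMinimal] {N : ℕ} [NeZero N]
    (D : ModularParametrizationData W N),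
    (∀ z ∈ D.L.lattice, ∃ w ∈ periodLattice D.f, z = D.c * w) → 3 ^ 2 ∣ N →
    periodLatticeGamma1 D.f ≠ periodLattice D.f →
    (∃ w ∈ periodLatticeGamma1 D.f, ¬ ∃ v ∈ periodLattice D.f, w = 3 * v) ∧
    ∀ w ∈ periodLatticeGamma1 D.f, (¬ ∃ v ∈ periodLattice D.f, w = 3 * v) →
      ∃ X r : ℚ, (D.c : ℂ) ^ 2 * D.L.weierstrassP ((D.c : ℂ) * w / 3) = (X : ℂ) ∧
        ((D.c : ℂ) ^ 3 * D.L.derivWeierstrassP ((D.c : ℂ) * w / 3) / 2) ^ 2 = -3 * (r : ℂ) ^ 2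

/-- **DICTΣ `KummerShimuraLattice` (support, KERNEL-PROVABLE lattice algebra, S/M): all `Γ₁(N)`-Kummer periods trivial ⟹
`Λ₁(f) ⊆ ℤ·(3u/c) + 3Λ₀(f)`** (`periodLatticeGamma1` is the closure of the `Γ₁(N)`-cusp symbols; `KummerPeriodTrivial` unrolled on generators,
`Λ_E = cΛ₀(f)` by optimality; `AddSubgroup.closure_le`).  With `ShimuraKernelMuTypeAtNine` it yields GENΣ: a `w ∈ Λ₁ ∖ 3Λ₀` has
`w = k·(3u/c) + 3v` with `3 ∤ k`, so `c·w/3 ≡ ±u (mod Λ_E)` and `Y₀² = (c³℘'(u)/2)² = (c³℘'(cw/3)/2)² ∈ −3ℚ²` — the `K`-point is of `μ₃`-type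
(edge GENΣ ⟸ E-an-201 ∧ DICTΣ ∧ (`Λ₁ ≠ Λ₀` from `Λ₁ ⊆ ℤ(3u/c) + 3Λ₀ ⊊ Λ₀`): M-sized Lean, offered to p2/p3).  Why it might fail: it cannot. [folklore] -/
@[conjecture]
def KummerShimuraLattice : Prop :=
  ∀ (W : WeierstrassCurve ℚ) [W.IsElliptic] [W.IsGloballyMinimal] {N : ℕ} [NeZero N]
    (D : ModularParametrizationData W N),
    (∀ z ∈ D.L.lattice, ∃ w ∈ periodLattice D.f, z = D.c * w) →
    ∀ u : ℂ, u ∉ D.L.lattice → 3 * u ∈ D.L.lattice → KummerShimura D u →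
    ∀ w ∈ periodLatticeGamma1 D.f, ∃ k : ℤ, ∃ v ∈ periodLattice D.f, w = k * (3 * u / D.c) + 3 * v

/-- **EXISTC `ReducibleShortThreeTorsionLiftC` (dictionary, theorem on paper): a reducible `E[3]` without rational points of order `3`
has a `K`-RATIONAL point of order `3` with rational abscissa, together with an analytic lift.**  (`p = 3`: reducible ⟺ Borel ⟺ a
Galois-stable line `⟨T⟩`; `x(T) = x(−T) ∈ ℚ`; `T ↔ u ∈ ⅓Λ_E ∖ Λ_E` under `ℂ/Λ_E ≅ E(ℂ)`, transported to the short model `E_{W,c}` as in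
tree S6 `shortThreeTorsionLift`.)  Why it might fail: only by mis-typing (`HasIrreducibleModPGaloisRep` is phrased through `geomTorsion`;
the link to affine coordinates is the tree's Galois-action API). [folklore] -/
@[conjecture]
def ReducibleShortThreeTorsionLiftC : Prop :=
  ∀ (W : WeierstrassCurve ℚ) [W.IsElliptic] [W.IsGloballyMinimal] {N : ℕ} [NeZero N]
    (D : ModularParametrizationData W N),
    ¬ W.HasIrreducibleModPGaloisRep 3 → (∀ X₀ Y₀ : ℚ, ¬ IsShortThreeTorsion W D.c X₀ Y₀) →
    ∃ (X₀ : ℚ) (Y₀ u : ℂ), IsShortThreeTorsionC W D.c X₀ Y₀ ∧ (∀ y : ℚ, Y₀ ≠ (y : ℂ)) ∧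
      u ∉ D.L.lattice ∧ 3 * u ∈ D.L.lattice ∧
      (D.c : ℂ) ^ 2 * D.L.weierstrassP u = (X₀ : ℂ) ∧ (D.c : ℂ) ^ 3 * D.L.derivWeierstrassP u / 2 = Y₀

/-- **RESΣ `ShimuraMuThreeCaseAtNine` (HONEST RESIDUAL of the split; OPEN; = Manin on the Shimura stratum).**  An optimal curve with
`9 ∣ N` carrying a `μ₃`-type `K`-point `T` of order `3` (rational abscissa) ALL of whose `Γ₁(N)`-Kummer periods are trivial (`φ₀^*μ₃ ⊂ Σ(N)`,
i.e. `E₁ = E₀/μ₃ ≠ E₀`) has `3 ∤ c`.  By the unconditional identity `n_u = ±c₀/c₁`, `n_φ n_u = 3` (module docstring) it SPLITS as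
`ShimuraCoverEtaleAtNine` (`|c₀| = |c₁|`, the Stevens fragment) ∧ (`3 ∤ c₁` on this stratum: the `Γ₁(N)`-Kummer line of the rational
`3`-torsion of `E₁` — `X(N) → X₁(N)` is totally ramified at `∞`, so every type-II triple cover of `X₁(N)` is noncongruence — or es's
E-es-110₃).  Habitat (`9 ∣ N ≤ 5000`): within RES₃♭'s ten classes EMPTY (all ten have a nontrivial period numerically); in general the classes
with `Λ₁(f) ≠ Λ₀(f)`: 27a1, 54a1 (`c₀ = c₁ = 1`; they carry rational `3`-torsion and leave RES₃♭ earlier).  Why it might fail: as Manin; no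
mechanism inside the UDC line (the Kummer cover IS congruence here). [cite: Vatsal2005, §1 Rem. 1.8 and Conj. 1.9 (Stevens)] -/
@[conjecture]
def ShimuraMuThreeCaseAtNine : Prop :=
  ∀ (W : WeierstrassCurve ℚ) [W.IsElliptic] [W.IsGloballyMinimal] {N : ℕ} [NeZero N]
    (D : ModularParametrizationData W N),
    (∀ z ∈ D.L.lattice, ∃ w ∈ periodLattice D.f, z = D.c * w) → 3 ^ 2 ∣ N →
    ∀ (X₀ : ℚ) (Y₀ : ℂ), IsShortThreeTorsionC W D.c X₀ Y₀ → IsMuThreeType Y₀ →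
    ∀ u : ℂ, u ∉ D.L.lattice → 3 * u ∈ D.L.lattice →
    (D.c : ℂ) ^ 2 * D.L.weierstrassP u = (X₀ : ℂ) → (D.c : ℂ) ^ 3 * D.L.derivWeierstrassP u / 2 = Y₀ →
    KummerShimura D u → ¬ (3 : ℤ) ∣ D.c

/-- **E-an-200 `ShimuraCoverEtaleAtNine` (the STEVENS FRAGMENT at additive `3`; candidate law, nothing asserted).**  For `ℚ`-isogenous
globally minimal `W₁, W₀` at level `N` with `9 ∣ N`, an OPTIMAL `X₁(N)`-datum `D₁` of `W₁` (`Λ_{E₁} = c₁Λ₁(f)`, Stevens' curve) and a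
lattice-optimal `X₀(N)`-datum `D₀` of `W₀`: if `Λ₁(f) ≠ Λ₀(f)` (the Shimura cover `E₁ → E₀` is a genuine `3`-isogeny, of `μ₃`-type kernel on
`E₀` by LEAD p1 g14) then `|c₀| = |c₁|`, i.e. the Shimura cover is ÉTALE (`n_u = ±1`) — equivalently the `μ₃`-isogeny `E₀ → E₁` has Lie
exponent `±3`.  In print: a consequence of Stevens' conjecture `E₁ = E*` [Vatsal 2005 Conj. 1.9], proved for semistable classes at odd `ℓ`
(Thm 1.10) and for `ℓ ≥ 7` ordinary reducible (Thm 1.11) — NOT at additive `3`.  Tree: `c₁ ∣ c₀ ∣ 3c₁` here (ČNS Lemma 6.5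
`cesnaviciusNeururerSaha_lemma_6_5_dvd_holds`; traceless converse).  BC5: 27a1 → 27a3 and 54a1 → 54a3 are the `Λ₁ ≠ Λ₀` classes met
(`v₃(n_φ) = 1` by Vélu, velu3-census-an-g39.out; `c₀ = c₁ = 1`); a violation forces `|c₀| = 3|c₁| ≥ 3`, excluded by Cremona's `c₀ = 1`
for `N ≤ 500000` (ARS 2006 / Cremona), so the law holds throughout that range.  Cheapest falsifier: an optimal `E₀`, `9 ∣ N`, with
`φ₀^*μ₃ ⊂ Σ(N)` (bounded `μ₃`-Kummer cube root) and `v₃(n_φ) = 0` — none among the 15 classes run (13 have `v₃(n_φ) = 0` AND an unbounded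
cube root).  Why it might fail: it is Stevens' conjecture at an additive prime, where Vatsal's Eisenstein/ordinarity method has no grip
(`μ₃ ⊄ V` is possible at non-semistable level — our 13 numerical examples); why novel: isolates the Lie exponent `n_φ` of the `μ₃`-isogeny
as the local invariant at `3` with `ord₃(c₀) − ord₃(c₁) = 1 − v₃(n_φ)` on the Shimura stratum.
[cite: Vatsal2005, Conj. 1.9, Thm. 1.10, Thm. 1.11, §1 p.4] [cite: Stevens1989, §2, Thm. 2.3] [cite: CesnaviciusNeururerSaha2023, Lemma 6.5 (shape)] -/
@[conjecture]
def ShimuraCoverEtaleAtNine : Prop :=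
  ∀ (W₁ W₀ : WeierstrassCurve ℚ) [W₁.IsElliptic] [W₁.IsGloballyMinimal] [W₀.IsElliptic] [W₀.IsGloballyMinimal] {N : ℕ} [NeZero N]
    (D₁ : Gamma1ParametrizationData W₁ N) (D₀ : ModularParametrizationData W₀ N),
    IsIsogenous W₁ W₀ → D₁.IsOptimal → (∀ z ∈ D₀.L.lattice, ∃ w ∈ periodLattice D₀.f, z = D₀.c * w) → 3 ^ 2 ∣ N →
    (∃ z ∈ periodLattice D₀.f, z ∉ periodLatticeGamma1 D₀.f) → |D₀.maninConstant| = |D₁.maninConstant|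

/-- **KLINE♮ `NonShimuraThreeTorsionCaseAtNineGermFree` (KLINE with the germ binders `a, z` discharged: `aₙ := aₙ(W)` via
`IsNewformOf`, the germ by the Theorems-side `exists_isParamGerm`; PROVED from KLINE on the Theorems side, file
ManinLocalTwoThreeUDCLineKAtNine-an-g39.lean `nonShimuraThreeTorsionCaseAtNineGermFree_of_kLine`).**  Same content as KLINE. [folklore] -/
@[conjecture]
def NonShimuraThreeTorsionCaseAtNineGermFree : Prop :=
  ∀ (W : WeierstrassCurve ℚ) [W.IsElliptic] [W.IsGloballyMinimal] {N : ℕ} [NeZero N]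
    (D : ModularParametrizationData W N), 3 ^ 2 ∣ N →
    (∀ z ∈ D.L.lattice, ∃ w ∈ periodLattice D.f, z = D.c * w) →
    ∀ (X₀ : ℚ) (Y₀ : ℂ), IsShortThreeTorsionC W D.c X₀ Y₀ →
    ∀ u : ℂ, u ∉ D.L.lattice → 3 * u ∈ D.L.lattice →
    (D.c : ℂ) ^ 2 * D.L.weierstrassP u = (X₀ : ℂ) → (D.c : ℂ) ^ 3 * D.L.derivWeierstrassP u / 2 = Y₀ →
    ¬ KummerShimura D u → ¬ (3 : ℤ) ∣ D.c

/-! ## §3 The split of RES₃♭ (pure logic) -/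

/-- **THE SPLIT (PROVED): RES₃♭ ⟸ EXISTC ∧ GENΣ ∧ KLINE♮ ∧ RESΣ.**  Excluded middle on `KummerShimura D u` and on `IsMuThreeType Y₀`;
clauses 1–7 of RES₃♭ are not used (they only shrink the habitat); the Theorems-side composition feeds KLINE♮ from
`nonShimuraThreeTorsionCaseAtNine_of_pieces` + `exists_isParamGerm`. [folklore] -/
theorem noRationalThreeTorsionCoprimeIsolatedResidual_of_kLine
    (hEX : ReducibleShortThreeTorsionLiftC) (hGEN : KummerNotShimuraOfGeneric)
    (hKL : NonShimuraThreeTorsionCaseAtNineGermFree)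
    (hRES : ShimuraMuThreeCaseAtNine) : NoRationalThreeTorsionCoprimeIsolatedResidual := by
  intro W _ _ N _ D hL h9 _ _ _ _ _ _ _ hred hT
  obtain ⟨X₀, Y₀, u, hTC, hirr, hu₁, hu₂, hX, hY⟩ := hEX W D hred hT
  by_cases hS : KummerShimura D u
  · by_cases hμ : IsMuThreeType Y₀
    · exact hRES W D hL h9 X₀ Y₀ hTC hμ u hu₁ hu₂ hX hY hS
    · exact fun _ ↦ hGEN W D hL h9 X₀ Y₀ hTC hirr hμ u hu₁ hu₂ hX hY hS
  · exact hKL W D h9 hL X₀ Y₀ hTC u hu₁ hu₂ hX hY hS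

end Summit.BirchSwinnertonDyer.Rank1Residual.ManinAdditive.UDCKummerLineK

end
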